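import Literature.Topology.FourManifolds.InfiniteCyclicCover
import Literature.Topology.FourManifolds.SeifertCircleMapProofs
import Literature.Topology.FourManifolds.DehnSurgeryFramingUniqueness
import HarnessLib

/-!
# The winding hypotheses of the infinite cyclic cover for a knot complement

Topic `Literature/Topology/FourManifolds`. For a knot `K ⊂ S³` with a tubular neighbourhood `ν`
and ANY circle-valued map `f : S³ ∖ K → S¹` along which the meridian winds once, the winding
homomorphism `f_* : π₁(S³ ∖ K, x₀) → ℤ` IS the abelianisation: its kernel is the commutator
subgroup, and `a ↦ (f̄_* a)⁻¹` is an isomorphism `e' : π₁ᵃᵇ ≃* ℤ` with `e' [g] = (f_* g)⁻¹` — the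
hypotheses `hker`, `e'`, `he'` of `AlexanderModuleCover.alexanderModuleEquiv` and
`CutData.exists_presentation_laurent` (the hypothesis `h₀` being the assumption itself). The input
is the tree's `H₁(S³ ∖ K) = ℤ⟨meridian⟩` (`Knot.TubularNbhd.exists_windingFun`,
`zpow_abelianization_meridian_injective`; Rolfsen (1976), §3.B, §7.A).

Everything is proved; no named fact is introduced.

## References

* D. Rolfsen, *Knots and Links*, Publish or Perish (1976), §3.B, §7.A. [Rolfsen1976]
* A. Hatcher, *Algebraic Topology* (2002), Prop. 1B.9, §2.A. [HatcherAT2002]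
-/

noncomputable section

open Set Function Multiplicative
open Literature.Topology.FourManifolds.CircleMaps

namespace Literature.Topology.FourManifolds

namespace Knot.TubularNbhd

variable {K : Knot} (ν : Knot.TubularNbhd K)

local notation "⟦" p "⟧ₚ" => Path.Homotopic.Quotient.mk p

/-- **`π₁ᵃᵇ` of a knot complement is the powers of the meridian**: every class is a power of
`[meridian]ᵃᵇ`. [cite: Rolfsen1976, §3.B] -/
theorem exists_abelianization_eq_meridian_zpow
    (a : Abelianization (FundamentalGroup K.complement ν.basePoint)) :
    ∃ n : ℤ, a = Abelianization.of (FundamentalGroup.fromPath ⟦ν.meridian⟧ₚ) ^ n := by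
  obtain ⟨φ, -, hchar, -⟩ := ν.exists_windingFun
  induction a using QuotientGroup.induction_on with | H g => ?_
  exact ⟨φ (FundamentalGroup.toPath g), hchar (FundamentalGroup.toPath g)⟩

variable (f : C(K.complement, Circle))

/-- The winding homomorphism on the abelianisation. [folklore] -/
def windingHomAb : Abelianization (FundamentalGroup K.complement ν.basePoint) →* Multiplicative ℤ :=
  Abelianization.lift (windingHom f ν.basePoint)

/-- `f̄_* [g] = f_* g`. [folklore] -/
@[simp] theorem windingHomAb_of (g : FundamentalGroup K.complement ν.basePoint) :
    ν.windingHomAb f (Abelianization.of g) = windingHom f ν.basePoint g :=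
  Abelianization.lift_apply_of _ _

variable {f} (h₀ : winding f ν.meridian = 1)
include h₀

/-- On the powers of the meridian, `f̄_*` is `n ↦ n`. [folklore] -/
theorem windingHomAb_meridian_zpow (n : ℤ) :
    ν.windingHomAb f (Abelianization.of (FundamentalGroup.fromPath ⟦ν.meridian⟧ₚ) ^ n) = ofAdd n := by
  rw [map_zpow, windingHomAb_of, windingHom_fromPath, h₀, ← ofAdd_zsmul, smul_eq_mul, mul_one]

/-- **`f̄_*` is bijective** when the meridian winds once. [cite: Rolfsen1976, §7.A] -/
theorem windingHomAb_bijective : Bijective (ν.windingHomAb f) := by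
  constructor
  · rw [← MonoidHom.ker_eq_bot_iff, eq_bot_iff]
    intro a ha
    rw [MonoidHom.mem_ker] at ha
    obtain ⟨n, rfl⟩ := ν.exists_abelianization_eq_meridian_zpow a
    rw [ν.windingHomAb_meridian_zpow h₀] at ha
    have hn : n = 0 := ofAdd_eq_one.1 ha
    rw [hn, zpow_zero]
    exact Subgroup.mem_bot.2 rfl
  · intro z
    refine ⟨Abelianization.of (FundamentalGroup.fromPath ⟦ν.meridian⟧ₚ) ^ (toAdd z), ?_⟩
    rw [ν.windingHomAb_meridian_zpow h₀, ofAdd_toAdd]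

/-- **Hypothesis `hker`**: the kernel of the winding homomorphism is the commutator subgroup.
[cite: Rolfsen1976, §7.A] -/
theorem ker_windingHom_eq_commutator :
    (windingHom f ν.basePoint).ker = commutator (FundamentalGroup K.complement ν.basePoint) := by
  rw [← Abelianization.ker_of]
  ext g
  rw [MonoidHom.mem_ker, MonoidHom.mem_ker, ← windingHomAb_of, ← (ν.windingHomAb f).map_one]
  exact (ν.windingHomAb_bijective h₀).1.eq_iff

/-- **Hypotheses `e'`, `he'`**: the isomorphism `π₁ᵃᵇ ≃* ℤ`, `[g] ↦ (f_* g)⁻¹`.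
[cite: Rolfsen1976, §7.A] -/
theorem exists_mulEquiv_inv_windingHom :
    ∃ e' : Abelianization (FundamentalGroup K.complement ν.basePoint) ≃* Multiplicative ℤ,
      ∀ g, e' (Abelianization.of g) = (windingHom f ν.basePoint g)⁻¹ :=
  ⟨(MulEquiv.ofBijective (ν.windingHomAb f) (ν.windingHomAb_bijective h₀)).trans (MulEquiv.inv _),
    fun g => by simp⟩

end Knot.TubularNbhd

end Literature.Topology.FourManifolds
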